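import Literature.MathematicalPhysics.QuantumFieldTheory.Balaban1983to89.B15Prop1CarrierOnFromLetters
import Literature.MathematicalPhysics.QuantumFieldTheory.Balaban1983to89.B15Prop1ChartSU2
import Literature.MathematicalPhysics.QuantumFieldTheory.Balaban1983to89.B15Prop1RelativeAxialGauge
import Literature.MathematicalPhysics.QuantumFieldTheory.Balaban1983to89.B15Prop1SliceCoordinates

/-!
# `Balaban1983to89.B15Prop1CarrierOnSU2Box` — T. Bałaban, *Large field renormalization. I. The basic step of the 𝐑 operation*,
Commun. Math. Phys. **122** (1989) 175–202 [Balaban1989LargeFieldI] («[IV]»), **Proposition 1** p. 194, proof [Balaban1989LargeFieldII]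
(«[LF-II]») pp. 358–359: **`B15.Prop1Printed` AT THE CARRIER OF RECORD FOR `G = SU(2)` ON PARALLELEPIPEDS, WITH PRINT'S
`x₁`-AXIAL GAUGE `G₀` AND THE PRINTED EXPONENTIAL CHART — all gauge-fixing and chart items of the N12 dictionary DISCHARGED**,
by knitting BY NAME: dag-n12-c's `B15Prop1CarrierOnFromLetters.prop1Printed_lfVarOn_of_letters` ((c1)/(c2)/(c4) derived from
object letters), lit-balaban-type-B15's `B15Prop1RelativeAxialGauge.exists_isGaugeOn_relSmall` (p465628: the `G₀`-representative on
a box and its bound `(n+2)(n+d)(a+ε)` — [LF-II] p. 359 l. 5–6 at the group level), and dag-n12-c's `B15Prop1ChartSU2` (p465147: the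
chart letters and the Ad-covariance at `SU(2)`).

statement-level skeleton of published theorems with citation tags; proofs where landed; nothing here is a claim about
the Yang–Mills mass gap

Cell pub-ymgap, HUMAN RULING D-0062 (Track A full width), seat `pub-ymgap-dag-n12-c` (R134 acceleration seat (a), strategy s1
of DAG node N12 = [B15]; generation g2, fifth product).  PDFs held: `paper:balaban1989-cmp122-large-field-i` (journal page =
PDF page + 174), `paper:balaban1989-cmp122-large-field-ii` (journal page = PDF page + 354).

THE PRINT ([LF-II] p. 358–359): *«For example, if in this domain Λ we fix an axial gauge in the direction of x₁-axis, i.e., we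
put B′((x − e₁, x)) = 0 for x ∈ Λ, then the inequality (1.8) holds with the constant (100M)³. … We fix such an extension, and we
consider the variational problem for the function V′↾_Λ → A(U_{k,Z}(V′V_k)), where V′ satisfies mild regularity conditions.
Fixing the gauge G₀ for V′ we get a small configuration, and we can write V′ = exp iB′.»*

WHAT THIS FILE PROVES (theorems only; Mathlib + the three imports; no `sorry`, no definition, no `… : Prop` fact; axioms
standard).  §1 `rep_x1_box` — the hypothesis hrep of `prop1Printed_lfVarOn_of_letters` AT PRINT'S OBJECTS (box `Λ`, `x₁`-axial
`T ⊆ G₀`, domain `domReg`), from `exists_isGaugeOn_relSmall`.  §2 **`prop1Printed_lfVarOn_su2_box`** — `B15.Prop1Printed (lfVarOn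
su2Chart I)` for box instances at `SU(2)` from: the expansion letters (m1)–(m5), (c3), (c3″), (x); the extension letters (ℓ2);
the coordinate facts (ι1)–(ι3); three thresholds.  No gauge-fixing or chart hypothesis remains: (c1), (c2), (c3′), (c4), (X),
(ℓ1), hrep are theorems here.

HONEST SCOPE.  (i) What remains displayed is NODE 00's: the expansion pieces `H_{1,k}`, `H*_{1,k}`, `Δ₁(ζ₀)`, `(δ/δA)V`, `J_{k,Z}`
OF RECORD with (1.9) on the range of `P₀` ((m1); at the box chart of the INNER bonds it is `B15Prop1BoxChartCarrier.ineq19_bspace`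
modulo the p. 357 perturbation letter — the `x₁`-axial slice here lives on the bonds MEETING `Λ`, a different coordinate space),
Proposition 4 [15]'s Lipschitz data ((m3)), the current bound ((m4)), the first-variation identity ((m5)/(c3)), the
analytic-extension clause ((x)), the (181)-covariance invariance ((c3″): `B15Prop1Carrier.std_f_gaugeAct` at print's instance),
the extension bound ((ℓ2): `B15Extension193.extension_box` for a box, corner plaquettes per G-B15-02), the coordinates ((ι1)–(ι3):
the pin's identification of `E i` with the fields supported off `G₀`).  (ii) `SU(2)`, `d ≥ 2`, boxes only.  (iii) Count-neutral;
NOT a discharge of N12; NOT summit progress.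

v1.1 (same seat, same day; APPEND-ONLY — §1–§2 byte-identical; one import added): §3 `prop1Printed_lfVarOn_su2_box_slice` — §2 at the
CONCRETE slice coordinates `E i := B15Prop1SliceCoordinates.GaugeSlice (Λ^{(k)}) (T i) ℝ³`, `P₀ = id`, `ιA` = extension by zero: the
coordinate facts (ι1)–(ι3) discharged (`coord_ι1/2/3`, p468327); remaining hypotheses = expansion letters + (c3) + (c3″) + (x) + (ℓ2)
+ thresholds.
-/

noncomputable section

open Set
open scoped RealInnerProductSpace Real

namespace Literature.MathematicalPhysics.QuantumFieldTheory.Balaban1983to89.B15Prop1CarrierOnSU2Box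

open B15DeterminingSets GaugeField B16Sect1Backgrounds B15Prop1Carrier B8Eq17ClassAkV1
open B15Prop1GaugeFixing B15Prop1CarrierOnFromModel B15Prop1CarrierOnFromLetters
open T4CubeChartGnomonic (SU2)
open B15Prop1ChartSU2 (su2Chart iexp_ilog norm_ilog_le dist1_iexp_le isCriticalPt_gaugeAct_su2)
open B15Prop1RelativeAxialGauge (exists_isGaugeOn_relSmall)
open T4AxialGaugeSmallField (castSite boxPlaqs)
open B7Prop1Explicit (e)

variable {P : Params}

/-! ## §1 hrep at print's objects: box, `x₁`-axial `G₀`, `domReg` -/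

/-- **The `G₀`-representative at print's `x₁`-axial gauge on a box, in assembly form.**  `d ≥ 2`; `Λ^{(k)} = castSite″[lo, hi]`
a box of at most `n + 1` sites per direction whose one-layer enlargement does not wrap and has its plaquettes inside `Z^{(k)}`;
`T ⊆ G₀` = `x₁`-bonds `⟨x − e₁, x⟩`, `x ∈ Λ`; the fixed extension `Ṽ` a value of the variables at `V_k`, `ε′`-regular inside
`Z^{(k)}`; `V` a value of the variables in the domain `domReg Z k a₁`.  Then (lit-balaban-type-B15's
`B15Prop1RelativeAxialGauge.exists_isGaugeOn_relSmall`, BY NAME, through `rep_of_bounds`) there is `u` defined on `Λ^{(k)}` with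
`V^u = Ṽ` on `T` and off the bonds meeting `Λ^{(k)}`, and `|V^u(b)Ṽ(b)⁻¹ − 1| < δc` on the bonds meeting `Λ^{(k)}` as soon as
`(n + 2)(n + d)(a₁ + ε′) < δc` — *«Fixing the gauge G₀ for V′ we get a small configuration»*.
[cite: Balaban1989LargeFieldII, pp.358–359 (proof of Proposition 1 [IV]); Balaban1989LargeFieldI, (1.77) p.194] -/
theorem rep_x1_box {k : ℕ} (hd : 2 ≤ P.d) {lo hi : Fin P.d → ℤ} {n : ℕ} (hn : ∀ κ, hi κ ≤ lo κ + n)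
    (hN : n + 2 < P.sitesPerDir k) {Λ Z : Set (Site P 0)} (hbox : pts k Λ = (castSite '' Icc lo hi : Set (Site P k)))
    (hZ : (boxPlaqs (lo - 1) (hi + 1) : Set (Plaq P k)) ⊆ plaqsInside (pts k Z))
    {μ₀ : Fin P.d} (hμ₀ : (μ₀ : ℕ) = 0) {T : Finset (PBond P k)}
    (hT : ∀ b ∈ T, ∃ x, x ∈ Icc lo hi ∧ b = ⟨castSite (x - e μ₀), μ₀⟩)
    {Vk Vt V : GaugeField P k SU2} (hVt : Vt ∈ extSet (bondsOf (pts k Λ)) Vk)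
    {a₁ ε' δc : ℝ} (ha₁ : 0 ≤ a₁) (hε' : 0 ≤ ε')
    (hVtZ : PlaqSmallOn (plaqsInside (pts k Z)) ε' Vt)
    (hV : V ∈ extSet (bondsOf (pts k Λ)) Vk ∩ domReg Z k a₁)
    (hδ : ((n : ℝ) + 2) * ((n : ℝ) + P.d) * (a₁ + ε') < δc) :
    ∃ u : GaugeTransf P k SU2, IsGaugeOn (pts k Λ) u ∧
      (∀ b, (b ∈ T ∨ b ∉ bondsOf (pts k Λ)) → gaugeAct u V b = Vt b) ∧
      ∀ b, b ∈ bondsOf (pts k Λ) → b ∉ T → dist1 (gaugeAct u V b * (Vt b)⁻¹) < δc := by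
  rw [hbox] at hVt hV ⊢
  have hVext : V ∈ extSet (bondsOf (castSite '' Icc lo hi : Set (Site P k))) Vt := by
    rw [extSet_eq_of_mem hVt]; exact hV.1
  have hW : PlaqSmallOn (boxPlaqs (lo - 1) (hi + 1)) a₁ V := fun p hp => (mem_domReg_iff.1 hV.2) p (hZ hp)
  have hVt' : PlaqSmallOn (boxPlaqs (lo - 1) (hi + 1)) ε' Vt := fun p hp => hVtZ p (hZ hp)
  obtain ⟨u, hu, hoff, hG0, hbound⟩ :=
    exists_isGaugeOn_relSmall hd hn hN V Vt ha₁ hε' hW hVt' fun b hb => (mem_extSet_iff.1 hVext) b hb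
  have hTag : ∀ b ∈ T, gaugeAct u V b = Vt b := by
    intro b hb
    obtain ⟨x, hx, rfl⟩ := hT b hb
    exact hG0 μ₀ hμ₀ x hx
  obtain ⟨h1, h2⟩ := rep_of_bounds hoff hTag hbound hδ
  exact ⟨u, hu, h1, h2⟩

/-! ## §2 Proposition 1 at the carrier of record for `SU(2)` on boxes -/

/-- **PROPOSITION 1 [IV] AT THE CARRIER OF RECORD FOR `G = SU(2)`, PARALLELEPIPEDS `Λ`, PRINT'S `x₁`-AXIAL `G₀` AND THE PRINTED
CHART — every gauge ∕ chart dictionary item DISCHARGED.**  Instances: `Λ^{(k)}` a box `castSite″[lo, hi]` of the torus (`≤ n + 1`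
sites per direction, the enlarged box non-wrapping with plaquettes inside `Z^{(k)}`), domain `domReg Z k a₁`, chart
`φ i V_k B = expPoint∘(ιA B) · Ṽ_k` (the `SU(2)` exponential chart `su2Chart` of `B15Prop1ChartSU2`), tree `T ⊆ G₀`.  REMAINING
HYPOTHESES = the p. 359 expansion letters (m1)–(m5) with (c3) `IsCriticalPt ⇔ (1.12)` (the expansion pieces OF RECORD), (c3″)
Λ-invariance of `f` ((181) covariance at print's instance), the analytic-extension clause (x), the extension letters (ℓ2) of the
fixed `Ṽ_k` ([IV] p. 193; for a box `B15Extension193.extension_box`), the coordinate facts (ι1)–(ι3) of the gauge-fixed space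
`E i`, and the thresholds (`N·(π/2)·δc ≤ r`, `(n+2)(n+d)(a₁ + b_xM²ε + ε) < δc`, `(8M⁵hst·cJ/γ + b_xM²)ε < a₁` for `ε ≤ eD`).
DISCHARGED BY NAME: (c1)/(c2)/(c4) (`prop1Printed_lfVarOn_of_letters`), the representative hrep (`rep_x1_box` ⇐
`B15Prop1RelativeAxialGauge`), the chart letters (X)/(ℓ1) and (c3′) (`B15Prop1ChartSU2.iexp_ilog`, `norm_ilog_le`, `dist1_iexp_le`,
`isCriticalPt_gaugeAct_su2`).  `B₅ = 8·hst·cJ/γ + b_x + 1`. [cite: Balaban1989LargeFieldI, Prop. 1 (1.77)–(1.78) p.194;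
Balaban1989LargeFieldII, pp.358–359 (proof of Proposition 1 [IV]), (1.9), (1.12)–(1.13); Balaban1985Variational, Prop. 4 p.293] -/
theorem prop1Printed_lfVarOn_su2_box (hd : 2 ≤ P.d) {ι : Type} (I : ι → InstOn P SU2)
    [∀ i, DecidableEq (PBond P (I i).k)]
    {E F : ι → Type*}
    [∀ i, NormedAddCommGroup (E i)] [∀ i, InnerProductSpace ℝ (E i)] [∀ i, FiniteDimensional ℝ (E i)]
    [∀ i, NormedAddCommGroup (F i)] [∀ i, InnerProductSpace ℝ (F i)]
    (P₀ : ∀ i, E i →ₗ[ℝ] E i) (hP2 : ∀ i x, P₀ i (P₀ i x) = P₀ i x) (hPsa : ∀ i (x y : E i), ⟪P₀ i x, y⟫ = ⟪x, P₀ i y⟫)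
    (H : ∀ i, GaugeField P (I i).k SU2 → (E i →ₗ[ℝ] F i)) (Hst : ∀ i, GaugeField P (I i).k SU2 → (F i →ₗ[ℝ] E i))
    (hadj : ∀ i Vk (x : E i) (y : F i), ⟪H i Vk x, y⟫ = ⟪x, Hst i Vk y⟫)
    (Δ₁ : ∀ i, GaugeField P (I i).k SU2 → (F i →ₗ[ℝ] F i)) (dV : ∀ i, GaugeField P (I i).k SU2 → F i → F i)
    (J : ∀ i, GaugeField P (I i).k SU2 → F i)
    -- the geometry of the instances: boxes on the torus, inside `Z`, with the `x₁`-axial tree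
    (lo hi : ι → Fin P.d → ℤ) (n : ι → ℕ) (hn : ∀ i κ, hi i κ ≤ lo i κ + n i) (hN : ∀ i, n i + 2 < P.sitesPerDir (I i).k)
    (hbox : ∀ i, pts (I i).k (I i).Λ = (castSite '' Icc (lo i) (hi i) : Set (Site P (I i).k)))
    (hZ : ∀ i, (boxPlaqs (lo i - 1) (hi i + 1) : Set (Plaq P (I i).k)) ⊆ plaqsInside (pts (I i).k (I i).Z))
    (μ₀ : Fin P.d) (hμ₀ : (μ₀ : ℕ) = 0)
    (T : ∀ i, Finset (PBond P (I i).k))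
    (hT : ∀ i, ∀ b ∈ T i, ∃ x, x ∈ Icc (lo i) (hi i) ∧ b = ⟨castSite (x - e μ₀), μ₀⟩)
    (ext : ∀ i, GaugeField P (I i).k SU2 → GaugeField P (I i).k SU2)
    (ιA : ∀ i, E i →ₗ[ℝ] VecField P (I i).k (EuclideanSpace ℝ (Fin 3)))
    {γ h₁ hst cJ bx : ℝ} (hγ : 0 < γ) (hh₁ : 0 ≤ h₁) (hhst : 0 ≤ hst) (hcJ : 0 ≤ cJ) (hbx : 0 ≤ bx)
    {ℓ ρ r eA eD a₁ δc N : ι → ℝ} (hℓ : ∀ i, 0 ≤ ℓ i) (hr : ∀ i, 0 < r i) (heA : ∀ i, 0 < eA i) (heD : ∀ i, 0 < eD i)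
    (hδc : ∀ i, 0 < δc i) (ha₁ : ∀ i, 0 ≤ a₁ i) (hM : ∀ i, 1 ≤ (I i).M)
    -- model letters
    (hpos : ∀ i Vk x, P₀ i x = x → γ / (I i).M ^ 5 * ‖x‖ ^ 2 ≤ ⟪H i Vk x, Δ₁ i Vk (H i Vk x)⟫)
    (hH : ∀ i Vk x, ‖H i Vk x‖ ≤ h₁ * ‖x‖) (hHst : ∀ i Vk z, ‖Hst i Vk z‖ ≤ hst * ‖z‖)
    (hdV0 : ∀ i Vk, dV i Vk 0 = 0)
    (hdV : ∀ i Vk (u v : F i), ‖u‖ ≤ ρ i → ‖v‖ ≤ ρ i → ‖dV i Vk u - dV i Vk v‖ ≤ ℓ i * ‖u - v‖)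
    (hρ : ∀ i, h₁ * r i ≤ ρ i) (hsmall : ∀ i, (I i).M ^ 5 / γ * hst * ℓ i * h₁ ≤ 1 / 2)
    (hA : ∀ i Vk (X δ : E i), HasDerivAt (fun s : ℝ => (I i).f (expMul su2Chart (ιA i (X + s • δ)) (ext i Vk)))
      (⟪δ, Hst i Vk (J i Vk)⟫ + ⟪δ, Hst i Vk (Δ₁ i Vk (H i Vk X))⟫ + ⟪δ, Hst i Vk (dV i Vk (H i Vk X))⟫) 0)
    (hJ : ∀ i ε Vk, 0 < ε → (lfVarOn su2Chart I).Regular i ε Vk → ‖J i Vk‖ ≤ cJ * ε)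
    (hc3 : ∀ i Vk (B : E i), P₀ i B = B → ‖B‖ ≤ r i →
      (IsCriticalPt su2Chart (bondsOf (pts (I i).k (I i).Λ)) (I i).f (expMul su2Chart (ιA i B) (ext i Vk)) ↔
        ∀ δB : E i, P₀ i δB = δB →
          ⟪δB, Hst i Vk (J i Vk)⟫ + ⟪δB, Hst i Vk (Δ₁ i Vk (H i Vk B))⟫ + ⟪δB, Hst i Vk (dV i Vk (H i Vk B))⟫ = 0))
    (hc3'' : ∀ i (u : GaugeTransf P (I i).k SU2) (V : GaugeField P (I i).k SU2), IsGaugeOn (pts (I i).k (I i).Λ) u →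
      (I i).f (gaugeAct u V) = (I i).f V)
    (hAn : ∀ i ε Vk, 0 < ε → ε ≤ eA i → (lfVarOn su2Chart I).Regular i ε Vk → (I i).An ε Vk)
    (hdom : ∀ i, (I i).dom = domReg (I i).Z (I i).k (a₁ i))
    (hext0 : ∀ i Vk, ext i Vk ∈ extSet (bondsOf (pts (I i).k (I i).Λ)) Vk)
    (hextZ : ∀ i ε Vk, 0 < ε → ε ≤ eD i → (lfVarOn su2Chart I).Regular i ε Vk →
      ∀ p ∈ plaqsInside (pts (I i).k (I i).Z), dist1 (plaqHol (ext i Vk) p) ≤ bx * (I i).M ^ 2 * ε)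
    (hextΛ : ∀ i ε Vk, 0 < ε → (lfVarOn su2Chart I).Regular i ε Vk →
      ∀ p ∈ plaqsOf (pts (I i).k (I i).Λ), dist1 (plaqHol (ext i Vk) p) ≤ bx * (I i).M ^ 2 * ε)
    (hι1 : ∀ i (B : E i), P₀ i B = B → IsSupportedOn {b | b ∈ bondsOf (pts (I i).k (I i).Λ) ∧ b ∉ T i} (ιA i B))
    (hι2 : ∀ i (A : VecField P (I i).k (EuclideanSpace ℝ (Fin 3))) (t : ℝ),
      IsSupportedOn {b | b ∈ bondsOf (pts (I i).k (I i).Λ) ∧ b ∉ T i} A →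
      (∀ b, ‖A b‖ ≤ t) → ∃ B : E i, P₀ i B = B ∧ ιA i B = A ∧ ‖B‖ ≤ N i * t)
    (hι3 : ∀ i (B : E i) (b : PBond P (I i).k), ‖ιA i B b‖ ≤ ‖B‖)
    -- thresholds
    (hN' : ∀ i, N i * (π / 2 * δc i) ≤ r i)
    (hδ : ∀ i ε, 0 < ε → ε ≤ eD i →
      ((n i : ℝ) + 2) * ((n i : ℝ) + P.d) * (a₁ i + (bx * (I i).M ^ 2 * ε + ε)) < δc i)
    (he1 : ∀ i ε, 0 < ε → ε ≤ eD i → (4 * 1 * (2 * (I i).M ^ 5 * hst * cJ / γ) + bx * (I i).M ^ 2) * ε < a₁ i) :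
    B15.Prop1Printed (lfVarOn su2Chart I) := by
  refine prop1Printed_lfVarOn_of_letters su2Chart I P₀ hP2 hPsa H Hst hadj Δ₁ dV J T ext ιA hγ hh₁ hhst hcJ hbx
    (κ := 1) zero_le_one (Cℓ := π / 2) (by positivity) hℓ hr heA heD hδc hM hpos hH hHst hdV0 hdV hρ hsmall hA hJ hc3
    (fun i u V hu hV => isCriticalPt_gaugeAct_su2 (fun u' hu' V' => hc3'' i u' V' hu') hu hV) hc3'' hAn hdom hext0 hextZ
    hextΛ (fun i g _ => iexp_ilog g) (fun i g _ => norm_ilog_le g) (fun X => by simpa using dist1_iexp_le X) hι1 hι2 hι3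
    ?_ hN' he1
  -- hrep at the `x₁`-axial `G₀` from the relative axial gauge (lit-balaban-type-B15)
  intro i ε Vk V hε hεD hreg hV
  have hε' : 0 ≤ bx * (I i).M ^ 2 * ε + ε := by positivity
  have hVtZ : PlaqSmallOn (plaqsInside (pts (I i).k (I i).Z)) (bx * (I i).M ^ 2 * ε + ε) (ext i Vk) :=
    fun p hp => (hextZ i ε Vk hε hεD hreg p hp).trans_lt (by linarith)
  rw [hdom i] at hV
  exact rep_x1_box hd (hn i) (hN i) (hbox i) (hZ i) hμ₀ (hT i) (hext0 i Vk) (ha₁ i) hε' hVtZ hV (hδ i ε hε hεD)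

/-! ## §3 The same with the slice coordinates `E i := GaugeSlice`: the coordinate facts discharged -/

section Slice

open B15Prop1SliceCoordinates (GaugeSlice ιA freeBonds coord_ι1 coord_ι2 coord_ι3)

/-- **v1.1 §3 — PROPOSITION 1 AT THE CARRIER OF RECORD, `SU(2)`, BOXES, `x₁`-AXIAL `G₀`, PRINTED CHART, AND THE CONCRETE SLICE
COORDINATES `E i := GaugeSlice (Λ^{(k)}) (T i) ℝ³` (`B15Prop1SliceCoordinates`, p468327; `P₀ = id`).**  The coordinate facts (ι1)–(ι3)
of §2 are now THEOREMS (`coord_ι1/2/3`, `N i = √|free bonds|`), so the REMAINING HYPOTHESES are exactly: the p. 359 expansion letters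
(m1) positivity (1.9) on the slice, (m2) `H*` adjoint, `‖H‖ ≤ h₁`, `‖H*‖ ≤ hst`, (m3) Proposition 4 [15] Lipschitz data + contraction
smallness, (m4) current bound, (m5) first variation of `B′ ↦ f(exp(i·ιA B′)·Ṽ_k)`, (c3) `IsCriticalPt ⇔ (1.12)` at slice points of
the ball, (c3″) Λ-invariance of `f`, (x) analytic extension, (ℓ2) extension letters, and the three thresholds — all indexed by the
expansion pieces OF RECORD (NODE 00) and the fixed extension.  [cite: Balaban1989LargeFieldI, Prop. 1 (1.77)–(1.78) p.194;
Balaban1989LargeFieldII, pp.358–359 (proof of Proposition 1 [IV]), (1.9), (1.12)–(1.13); Balaban1985Variational, Prop. 4 p.293] -/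
theorem prop1Printed_lfVarOn_su2_box_slice (hd : 2 ≤ P.d) {ι : Type} (I : ι → InstOn P SU2)
    [∀ i, DecidableEq (PBond P (I i).k)]
    (T : ∀ i, Finset (PBond P (I i).k))
    {F : ι → Type*} [∀ i, NormedAddCommGroup (F i)] [∀ i, InnerProductSpace ℝ (F i)]
    (H : ∀ i, GaugeField P (I i).k SU2 →
      (GaugeSlice (pts (I i).k (I i).Λ) (T i) (EuclideanSpace ℝ (Fin 3)) →ₗ[ℝ] F i))
    (Hst : ∀ i, GaugeField P (I i).k SU2 →
      (F i →ₗ[ℝ] GaugeSlice (pts (I i).k (I i).Λ) (T i) (EuclideanSpace ℝ (Fin 3))))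
    (hadj : ∀ i Vk (x : GaugeSlice (pts (I i).k (I i).Λ) (T i) (EuclideanSpace ℝ (Fin 3))) (y : F i),
      ⟪H i Vk x, y⟫ = ⟪x, Hst i Vk y⟫)
    (Δ₁ : ∀ i, GaugeField P (I i).k SU2 → (F i →ₗ[ℝ] F i)) (dV : ∀ i, GaugeField P (I i).k SU2 → F i → F i)
    (J : ∀ i, GaugeField P (I i).k SU2 → F i)
    (lo hi : ι → Fin P.d → ℤ) (n : ι → ℕ) (hn : ∀ i κ, hi i κ ≤ lo i κ + n i) (hN : ∀ i, n i + 2 < P.sitesPerDir (I i).k)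
    (hbox : ∀ i, pts (I i).k (I i).Λ = (castSite '' Icc (lo i) (hi i) : Set (Site P (I i).k)))
    (hZ : ∀ i, (boxPlaqs (lo i - 1) (hi i + 1) : Set (Plaq P (I i).k)) ⊆ plaqsInside (pts (I i).k (I i).Z))
    (μ₀ : Fin P.d) (hμ₀ : (μ₀ : ℕ) = 0)
    (hT : ∀ i, ∀ b ∈ T i, ∃ x, x ∈ Icc (lo i) (hi i) ∧ b = ⟨castSite (x - e μ₀), μ₀⟩)
    (ext : ∀ i, GaugeField P (I i).k SU2 → GaugeField P (I i).k SU2)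
    {γ h₁ hst cJ bx : ℝ} (hγ : 0 < γ) (hh₁ : 0 ≤ h₁) (hhst : 0 ≤ hst) (hcJ : 0 ≤ cJ) (hbx : 0 ≤ bx)
    {ℓ ρ r eA eD a₁ δc : ι → ℝ} (hℓ : ∀ i, 0 ≤ ℓ i) (hr : ∀ i, 0 < r i) (heA : ∀ i, 0 < eA i) (heD : ∀ i, 0 < eD i)
    (hδc : ∀ i, 0 < δc i) (ha₁ : ∀ i, 0 ≤ a₁ i) (hM : ∀ i, 1 ≤ (I i).M)
    (hpos : ∀ i Vk (x : GaugeSlice (pts (I i).k (I i).Λ) (T i) (EuclideanSpace ℝ (Fin 3))),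
      γ / (I i).M ^ 5 * ‖x‖ ^ 2 ≤ ⟪H i Vk x, Δ₁ i Vk (H i Vk x)⟫)
    (hH : ∀ i Vk x, ‖H i Vk x‖ ≤ h₁ * ‖x‖) (hHst : ∀ i Vk z, ‖Hst i Vk z‖ ≤ hst * ‖z‖)
    (hdV0 : ∀ i Vk, dV i Vk 0 = 0)
    (hdV : ∀ i Vk (u v : F i), ‖u‖ ≤ ρ i → ‖v‖ ≤ ρ i → ‖dV i Vk u - dV i Vk v‖ ≤ ℓ i * ‖u - v‖)
    (hρ : ∀ i, h₁ * r i ≤ ρ i) (hsmall : ∀ i, (I i).M ^ 5 / γ * hst * ℓ i * h₁ ≤ 1 / 2)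
    (hA : ∀ i Vk (X δ : GaugeSlice (pts (I i).k (I i).Λ) (T i) (EuclideanSpace ℝ (Fin 3))),
      HasDerivAt (fun s : ℝ => (I i).f (expMul su2Chart (ιA (pts (I i).k (I i).Λ) (T i) (X + s • δ)) (ext i Vk)))
      (⟪δ, Hst i Vk (J i Vk)⟫ + ⟪δ, Hst i Vk (Δ₁ i Vk (H i Vk X))⟫ + ⟪δ, Hst i Vk (dV i Vk (H i Vk X))⟫) 0)
    (hJ : ∀ i ε Vk, 0 < ε → (lfVarOn su2Chart I).Regular i ε Vk → ‖J i Vk‖ ≤ cJ * ε)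
    (hc3 : ∀ i Vk (B : GaugeSlice (pts (I i).k (I i).Λ) (T i) (EuclideanSpace ℝ (Fin 3))), ‖B‖ ≤ r i →
      (IsCriticalPt su2Chart (bondsOf (pts (I i).k (I i).Λ)) (I i).f
          (expMul su2Chart (ιA (pts (I i).k (I i).Λ) (T i) B) (ext i Vk)) ↔
        ∀ δB : GaugeSlice (pts (I i).k (I i).Λ) (T i) (EuclideanSpace ℝ (Fin 3)),
          ⟪δB, Hst i Vk (J i Vk)⟫ + ⟪δB, Hst i Vk (Δ₁ i Vk (H i Vk B))⟫ + ⟪δB, Hst i Vk (dV i Vk (H i Vk B))⟫ = 0))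
    (hc3'' : ∀ i (u : GaugeTransf P (I i).k SU2) (V : GaugeField P (I i).k SU2), IsGaugeOn (pts (I i).k (I i).Λ) u →
      (I i).f (gaugeAct u V) = (I i).f V)
    (hAn : ∀ i ε Vk, 0 < ε → ε ≤ eA i → (lfVarOn su2Chart I).Regular i ε Vk → (I i).An ε Vk)
    (hdom : ∀ i, (I i).dom = domReg (I i).Z (I i).k (a₁ i))
    (hext0 : ∀ i Vk, ext i Vk ∈ extSet (bondsOf (pts (I i).k (I i).Λ)) Vk)
    (hextZ : ∀ i ε Vk, 0 < ε → ε ≤ eD i → (lfVarOn su2Chart I).Regular i ε Vk →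
      ∀ p ∈ plaqsInside (pts (I i).k (I i).Z), dist1 (plaqHol (ext i Vk) p) ≤ bx * (I i).M ^ 2 * ε)
    (hextΛ : ∀ i ε Vk, 0 < ε → (lfVarOn su2Chart I).Regular i ε Vk →
      ∀ p ∈ plaqsOf (pts (I i).k (I i).Λ), dist1 (plaqHol (ext i Vk) p) ≤ bx * (I i).M ^ 2 * ε)
    -- thresholds (`N i = √|free bonds|`)
    (hN' : ∀ i, Real.sqrt (freeBonds (pts (I i).k (I i).Λ) (T i)).card * (π / 2 * δc i) ≤ r i)
    (hδ : ∀ i ε, 0 < ε → ε ≤ eD i →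
      ((n i : ℝ) + 2) * ((n i : ℝ) + P.d) * (a₁ i + (bx * (I i).M ^ 2 * ε + ε)) < δc i)
    (he1 : ∀ i ε, 0 < ε → ε ≤ eD i → (4 * 1 * (2 * (I i).M ^ 5 * hst * cJ / γ) + bx * (I i).M ^ 2) * ε < a₁ i) :
    B15.Prop1Printed (lfVarOn su2Chart I) :=
  prop1Printed_lfVarOn_su2_box hd I (E := fun i => GaugeSlice (pts (I i).k (I i).Λ) (T i) (EuclideanSpace ℝ (Fin 3)))
    (fun _ => LinearMap.id) (fun _ _ => rfl) (fun _ _ _ => rfl) H Hst hadj Δ₁ dV J lo hi n hn hN hbox hZ μ₀ hμ₀ T hT ext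
    (fun i => ιA (pts (I i).k (I i).Λ) (T i)) hγ hh₁ hhst hcJ hbx hℓ hr heA heD hδc ha₁ hM
    (fun i Vk x _ => hpos i Vk x) hH hHst hdV0 hdV hρ hsmall hA hJ (fun i Vk B _ hBr => (hc3 i Vk B hBr).trans ⟨fun h δB _ => h δB, fun h δB => h δB rfl⟩) hc3'' hAn hdom
    hext0 hextZ hextΛ (fun _ => coord_ι1 _ _) (fun _ => coord_ι2 _ _) (fun _ => coord_ι3 _ _) hN' hδ he1

end Slice

end Literature.MathematicalPhysics.QuantumFieldTheory.Balaban1983to89.B15Prop1CarrierOnSU2Box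

end
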